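import Summits.KontsevichZagierPeriods.KontsevichZagierPeriods.Theorems.TerasomaMultiplicationBetaCancellationStubTameFormAux1
import Summits.KontsevichZagierPeriods.KontsevichZagierPeriods.Theorems.TerasomaMultiplicationBetaCancellationStubTameFormAux3

/-!
# `BetaCancellation` (stmt-KontsevichZagierPeriods-13633), line `divisor-slicing-transshipment` — stub `stub_tameForm`, auxiliary file 5: composition of `MIso`

**Transitivity of finite piecewise measure isomorphisms** (`MIso.trans`): an `MIso N σ ρ τ θ` and an
`MIso N τ θ υ η` compose to an `MIso N σ ρ υ η` when the source densities `ρ` are positive on the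
source slots and the middle slots `τ` are `ℚ`-semialgebraic. The composite pieces are the
`P ∩ Ψ⁻¹ Q` (for pieces `(P, Ψ)` of the first and `(Q, Φ)` of the second isomorphism with matching
middle slot), with maps `Φ ∘ Ψ` (chain rule within the pieces, determinants multiply). The null
defects are controlled by the two tools of auxiliary file 3: images of null sets are null, and
preimages of null sets within a piece are null (the Jacobian of `Ψ` has non-zero determinant by
positivity of the densities).

References: M. Kontsevich, D. Zagier, *Periods* (2001), §1.2; crux NOTES c6 (F13).
-/

noncomputable section

-- `Summit.KontsevichZagierPeriods.KontsevichZagierPeriods.…` is the tree's mandated layout (single-conjunct summit).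
set_option linter.dupNamespace false

namespace Summit.KontsevichZagierPeriods.KontsevichZagierPeriods.BetaCancellationDivisorSlicing

open MeasureTheory Set Function
open Literature.NumberTheory.Transcendental
open Literature.NumberTheory.Transcendental.KZ
open Literature.ModelTheory.ExponentialFields (IsSemialgebraic isSemialgebraic_univ)

namespace MIso

variable {N : ℕ} {ι κ ν : Type*} {σ : ι → Set (Fin N → ℝ)} {ρ : ι → (Fin N → ℝ) → ℝ}
  {τ : κ → Set (Fin N → ℝ)} {θ : κ → (Fin N → ℝ) → ℝ}
  {υ : ν → Set (Fin N → ℝ)} {η : ν → (Fin N → ℝ) → ℝ}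

/-- The determinant of a composite of continuous linear endomorphisms is the product of the
determinants. [folklore] -/
theorem det_comp'' (A B : (Fin N → ℝ) →L[ℝ] (Fin N → ℝ)) : (A.comp B).det = A.det * B.det := by
  exact LinearMap.det_comp _ _

/-- **Composition of finite piecewise measure isomorphisms.** [folklore] -/
theorem trans [Fintype ι] [Fintype κ] [Fintype ν] (m₁ : MIso N σ ρ τ θ) (m₂ : MIso N τ θ υ η)
    (hρ : ∀ i, ∀ z ∈ σ i, 0 < ρ i z) (hτ : ∀ k, IsSemialgebraic ℚ (τ k)) :
    Nonempty (MIso N σ ρ υ η) := by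
  classical
  -- shorthand
  have hdet : ∀ j, ∀ z ∈ m₁.P j, (m₁.Ψ' j z).det ≠ 0 := fun j z hz =>
    (det_ne_zero_of_density ((m₁.piece j).2.2.2.2.2.2 z hz) (hρ _ z ((m₁.piece j).2.1 hz))).1
  -- preimages within a piece of the first isomorphism of null semialgebraic sets are null
  have hpre : ∀ j (T : Set (Fin N → ℝ)), IsSemialgebraic ℚ T → volume T = 0 →
      volume (m₁.P j ∩ m₁.Ψ j ⁻¹' T) = 0 := fun j T hT hT0 =>
    volume_inter_preimage_null (m₁.piece j).2.2.2.2.1 (m₁.piece j).2.2.2.1 (hdet j)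
      (Literature.ModelTheory.ExponentialFields.IsSemialgebraic.measurableSet_holds
        (isSemialgebraic_inter_preimage (m₁.piece j).2.2.1 hT)) hT0
  -- the composite pieces, indexed by matching pairs
  let I := {p : Fin m₁.J × Fin m₂.J // m₁.tgt p.1 = m₂.src p.2}
  let Pc : I → Set (Fin N → ℝ) := fun p => m₁.P p.1.1 ∩ m₁.Ψ p.1.1 ⁻¹' m₂.P p.1.2
  have hPc : ∀ p : I, Pc p ⊆ m₁.P p.1.1 := fun p => inter_subset_left
  have hmaps : ∀ p : I, MapsTo (m₁.Ψ p.1.1) (Pc p) (m₂.P p.1.2) := fun p z hz => hz.2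
  refine of_fintype (P₀ := I) (fun p => m₁.src p.1.1) (fun p => m₂.tgt p.1.2) Pc
    (fun p => m₂.Ψ p.1.2 ∘ m₁.Ψ p.1.1)
    (fun p z => (m₂.Ψ' p.1.2 (m₁.Ψ p.1.1 z)).comp (m₁.Ψ' p.1.1 z)) (fun p => ?_) ?_ ?_ ?_ ?_
  · -- each composite piece is a piece
    obtain ⟨⟨j, l⟩, hjl⟩ := p
    have hjl' : m₁.tgt j = m₂.src l := hjl
    obtain ⟨a1, a2, a3, a4, a5, a6, a7⟩ := m₁.piece j
    obtain ⟨b1, b2, b3, b4, b5, b6, b7⟩ := m₂.piece l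
    have hPs : IsSemialgebraic ℚ (Pc ⟨(j, l), hjl⟩) := isSemialgebraic_inter_preimage a3 b1
    refine ⟨hPs, (hPc _).trans a2, ?_, ?_, fun z hz => ?_, ?_, fun z hz => ?_⟩
    · exact IsSemialgebraicMapOn.comp_holds b3 (a3.mono (hPc _) hPs) (hmaps _)
    · exact b4.comp (a4.mono (hPc _)) (hmaps _)
    · exact (b5 _ (hmaps _ hz)).comp z ((a5 z hz.1).mono (hPc _)) (hmaps _)
    · rintro _ ⟨z, hz, rfl⟩
      exact b6 ⟨_, hmaps _ hz, rfl⟩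
    · have hb : θ (m₁.tgt j) (m₁.Ψ j z) =
          η (m₂.tgt l) (m₂.Ψ l (m₁.Ψ j z)) * |(m₂.Ψ' l (m₁.Ψ j z)).det| := by
        rw [hjl']
        exact b7 _ (hmaps _ hz)
      show ρ (m₁.src j) z =
        η (m₂.tgt l) ((m₂.Ψ l ∘ m₁.Ψ j) z) * |((m₂.Ψ' l (m₁.Ψ j z)).comp (m₁.Ψ' j z)).det|
      rw [Function.comp_apply, a7 z hz.1, hb, det_comp'', abs_mul]
      ring
  · -- a.e. disjointness in the source slots
    rintro ⟨⟨j, l⟩, hjl⟩ ⟨⟨j', l'⟩, hjl'⟩ hne hsrc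
    simp only at hsrc
    by_cases hj : j = j'
    · subst hj
      have hl : l ≠ l' := fun h => hne (by subst h; rfl)
      have : Pc ⟨(j, l), hjl⟩ ∩ Pc ⟨(j, l'), hjl'⟩ ⊆ m₁.P j ∩ m₁.Ψ j ⁻¹' (m₂.P l ∩ m₂.P l') := by
        rintro z ⟨⟨hz, hzl⟩, ⟨-, hzl'⟩⟩
        exact ⟨hz, hzl, hzl'⟩
      exact measure_mono_null this (hpre j _ ((m₂.piece l).1.inter (m₂.piece l').1)
        (m₂.disjoint_src l l' hl (hjl.symm.trans hjl')))
    · exact measure_mono_null (inter_subset_inter (hPc _) (hPc _)) (m₁.disjoint_src j j' hj hsrc)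
  · -- a.e. disjointness in the target slots
    rintro ⟨⟨j, l⟩, hjl⟩ ⟨⟨j', l'⟩, hjl'⟩ hne htgt
    simp only at htgt
    have himg : ∀ (j₀ l₀) (h₀ : m₁.tgt j₀ = m₂.src l₀),
        (m₂.Ψ l₀ ∘ m₁.Ψ j₀) '' Pc ⟨(j₀, l₀), h₀⟩ = m₂.Ψ l₀ '' (m₂.P l₀ ∩ m₁.Ψ j₀ '' m₁.P j₀) := by
      intro j₀ l₀ h₀
      rw [image_comp]
      congr 1
      ext y
      constructor
      · rintro ⟨z, hz, rfl⟩
        exact ⟨hz.2, z, hz.1, rfl⟩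
      · rintro ⟨hy, z, hz, rfl⟩
        exact ⟨z, ⟨hz, hy⟩, rfl⟩
    by_cases hl : l = l'
    · subst hl
      have hj : j ≠ j' := fun h => hne (by subst h; rfl)
      rw [himg, himg, ← (m₂.piece l).2.2.2.1.image_inter inter_subset_left inter_subset_left]
      refine volume_image_null_of_hasFDerivWithinAt (m₂.piece l).2.2.2.2.1
        (fun y hy => hy.1.1) (measure_mono_null ?_ (m₁.disjoint_tgt j j' hj (hjl.trans hjl'.symm)))
      rintro y ⟨⟨-, hy⟩, ⟨-, hy'⟩⟩
      exact ⟨hy, hy'⟩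
    · refine measure_mono_null (inter_subset_inter ?_ ?_) (m₂.disjoint_tgt l l' hl htgt)
      · rw [himg]
        exact image_mono inter_subset_left
      · rw [himg]
        exact image_mono inter_subset_left
  · -- a.e. covering of the source slots
    intro i
    have hsub : σ i \ (⋃ (p : I) (_ : m₁.src p.1.1 = i), Pc p) ⊆
        (σ i \ ⋃ (j) (_ : m₁.src j = i), m₁.P j) ∪
          ⋃ j, (m₁.P j ∩ m₁.Ψ j ⁻¹' (τ (m₁.tgt j) \ ⋃ (l) (_ : m₂.src l = m₁.tgt j), m₂.P l)) := by
      intro z hz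
      simp only [Set.mem_sdiff, mem_iUnion, exists_prop, not_exists, not_and, mem_union,
        mem_inter_iff, mem_preimage] at hz ⊢
      by_cases h : ∃ j, m₁.src j = i ∧ z ∈ m₁.P j
      · obtain ⟨j, hj, hzj⟩ := h
        refine Or.inr ⟨j, hzj, (m₁.piece j).2.2.2.2.2.1 ⟨z, hzj, rfl⟩, fun l hl hzl => ?_⟩
        exact hz.2 ⟨(j, l), hl.symm⟩ hj ⟨hzj, hzl⟩
      · push Not at h
        exact Or.inl ⟨hz.1, h⟩
    refine measure_mono_null hsub (measure_union_null (m₁.cover_src i)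
      (measure_iUnion_null_iff.mpr fun j => hpre j _ ?_ (m₂.cover_src _)))
    have hU : IsSemialgebraic ℚ (⋃ (l) (_ : m₂.src l = m₁.tgt j), m₂.P l) := by
      have := Literature.ModelTheory.ExponentialFields.IsSemialgebraic.biUnion
        (Finset.univ.filter fun l => m₂.src l = m₁.tgt j) m₂.P (fun l _ => (m₂.piece l).1)
      convert this using 1
      ext y
      simp
    exact (hτ _).diff hU
  · -- a.e. covering of the target slots
    intro k
    have hsub : υ k \ (⋃ (p : I) (_ : m₂.tgt p.1.2 = k), (m₂.Ψ p.1.2 ∘ m₁.Ψ p.1.1) '' Pc p) ⊆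
        (υ k \ ⋃ (l) (_ : m₂.tgt l = k), m₂.Ψ l '' m₂.P l) ∪
          ⋃ l, m₂.Ψ l '' (m₂.P l \ ⋃ (j) (_ : m₁.tgt j = m₂.src l), m₁.Ψ j '' m₁.P j) := by
      intro y hy
      simp only [Set.mem_sdiff, mem_iUnion, exists_prop, not_exists, not_and, mem_union] at hy ⊢
      by_cases h : ∃ l, m₂.tgt l = k ∧ y ∈ m₂.Ψ l '' m₂.P l
      · obtain ⟨l, hl, w, hw, rfl⟩ := h
        refine Or.inr ⟨l, w, ⟨hw, ?_⟩, rfl⟩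
        simp only [mem_iUnion, exists_prop, not_exists, not_and]
        rintro j hj ⟨z, hz, rfl⟩
        exact hy.2 ⟨(j, l), hj⟩ hl ⟨z, ⟨hz, hw⟩, rfl⟩
      · push Not at h
        exact Or.inl ⟨hy.1, h⟩
    refine measure_mono_null hsub (measure_union_null (m₂.cover_tgt k)
      (measure_iUnion_null_iff.mpr fun l => ?_))
    exact volume_image_null_of_hasFDerivWithinAt (m₂.piece l).2.2.2.2.1 sdiff_subset
      (measure_mono_null (sdiff_subset_sdiff_left (m₂.piece l).2.1) (m₁.cover_tgt _))

end MIso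

/-! ### Headline -/

/-- Registered helper goal of the stub `stub_tameForm`: composition of finite piecewise measure
isomorphisms. [folklore] -/
theorem tameForm_aux_misoTrans : ∀ {N : ℕ} {ι κ ν : Type} [Fintype ι] [Fintype κ] [Fintype ν] {σ : ι → Set (Fin N → ℝ)} {ρ : ι → (Fin N → ℝ) → ℝ} {τ : κ → Set (Fin N → ℝ)} {θ : κ → (Fin N → ℝ) → ℝ} {υ : ν → Set (Fin N → ℝ)} {η : ν → (Fin N → ℝ) → ℝ}, MIso N σ ρ τ θ → MIso N τ θ υ η → (∀ i, ∀ z ∈ σ i, 0 < ρ i z) → (∀ k, IsSemialgebraic ℚ (τ k)) → Nonempty (MIso N σ ρ υ η) :=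
  fun m₁ m₂ hρ hτ => m₁.trans m₂ hρ hτ

end Summit.KontsevichZagierPeriods.KontsevichZagierPeriods.BetaCancellationDivisorSlicing

end
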